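import Mathlib.Probability.UniformOn
import Literature.Probability.RandomPlanarGeometry.USTPeanoDomain
import HarnessLib

/-!
# The UST Peano path of a domain `D(α, β, a, b)` ([LSW04] §4.1)

G. F. Lawler, O. Schramm, W. Werner, Ann. Probab. **32** (2004), §4.1, pp. 971–972, show that
for `D = D(α, β, a, b) ∈ 𝔇*` the map `T ↦ γ(T)` — "the set of all edges of `G⃗` which do not
intersect `T ∪ T†` and which have at least one endpoint in `D`" — "is a bijection between the set
of spanning trees of `H` containing `α` and the set of oriented paths in `G⃗ ∩ D̄` from `a` to `b`
containing `V_P`. Hence, when `T` is the UST on `H` conditioned to contain `α`, `γ` is uniformly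
distributed among such Peano paths; it is the UST Peano path associated with `(α, β, a, b)`."

Following this sentence we DEFINE the UST Peano path directly as the uniform probability measure
on the finite set of such paths (no spanning trees, Wilson's algorithm or planar duality are
needed to state [LSW04] Thm. 4.4 / Prop. 4.5):

* `USTPeano.PeanoPath D` — the oriented simple paths `a = w₀ → w₁ → ⋯ → w_{ℓ+1} = b` of the
  Manhattan lattice `G⃗` whose vertices other than `a, b` are exactly the Peano vertices in `D`
  (LSW's `V_P` is the set of Peano vertices of `D̄`, i.e. `{a, b} ∪ peanoVerts D`; the path is
  Hamiltonian on it, `ℓ = |V_P(D)|`) and whose edges do not meet `α ∪ β` (they are edges "which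
  do not intersect `T ∪ T† ⊇ α ∪ β`", equivalently they stay in `D̄`); a finite type
  (`PeanoPath.instFinite`), with the discrete σ-algebra (`⊤`; measurability downstream is
  `Measurable.of_discrete`);
* `USTPeano.ustLaw D : Measure (PeanoPath D)` — **the law of the UST Peano path**, the uniform
  measure (`ProbabilityTheory.uniformOn univ`); a probability measure as soon as a Peano path
  exists (`isProbabilityMeasure_ustLaw`; existence for every `D ∈ 𝔇*` is LSW's bijection with
  spanning trees, vendored separately as a named fact);
* `PeanoPath.curve` — the path as a polygonal curve `[0, ℓ + 1] → ℂ` from `a` to `b` (unit time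
  per edge), the curve `γ` to which [LSW04] §4.2 applies the conformal map `φ : D → ℍ`.

Also: the Markov-type restriction data are NOT formalised here (Lemma 4.1 is not needed for the
statements of Thm. 4.4 / Prop. 4.5).
-/

noncomputable section

open Set Function MeasureTheory

namespace Literature.Probability.RandomPlanarGeometry

namespace USTPeano

variable (D : Domain)

/-- **A Peano path of `D = D(α, β, a, b)`** ([LSW04] pp. 971–972): an oriented simple path
`a = w₀, w₁, …, w_{ℓ+1} = b` in the Manhattan lattice `G⃗` (consecutive vertices joined by a
Manhattan edge, no repeated vertex) whose set of vertices is `{a, b} ∪ V_P(D)` (it visits every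
Peano vertex of `D` and, apart from its endpoints on `∂D`, nothing else) and whose (closed) edges
do not meet the lattice paths `α`, `β` ("edges of `G⃗` which do not intersect `T ∪ T†`", with
`α ⊆ T`, `β ⊆ T†`). By LSW's bijection `T ↦ γ(T)` these are exactly the UST Peano paths.
[cite: LawlerSchrammWerner2004, §4.1] -/
structure PeanoPath where
  /-- the vertices `w₀ = a, …, w_{ℓ+1} = b` (Peano indices) -/
  verts : List (ℤ × ℤ)
  ne_nil : verts ≠ []
  /-- the path starts at `a` -/
  head_eq : verts.head ne_nil = D.a
  /-- the path ends at `b` -/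
  getLast_eq : verts.getLast ne_nil = D.b
  /-- consecutive vertices are joined by an edge of `G⃗` (Manhattan orientation respected) -/
  isChain : verts.IsChain Manhattan
  /-- the path is simple -/
  nodup : verts.Nodup
  /-- the vertex set is `{a, b} ∪ V_P(D)` -/
  mem_iff : ∀ p, p ∈ verts ↔ p = D.a ∨ p = D.b ∨ p ∈ D.peanoVerts
  /-- the edges do not meet `α ∪ β` -/
  disjoint_edge : ∀ e ∈ verts.zip verts.tail,
    Disjoint (segment ℝ (peanoPt e.1) (peanoPt e.2)) D.latticeBoundary

namespace PeanoPath

variable {D}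

/-- A Peano path is determined by its vertex list. [folklore] -/
theorem verts_injective : Injective (PeanoPath.verts (D := D)) := by
  rintro ⟨v, _, _, _, _, _, _, _⟩ ⟨v', _, _, _, _, _, _, _⟩ h
  cases h
  rfl

/-- `a` is a vertex of every Peano path. [folklore] -/
theorem a_mem_verts (γ : PeanoPath D) : D.a ∈ γ.verts := (γ.mem_iff _).2 (Or.inl rfl)

/-- `b` is a vertex of every Peano path. [folklore] -/
theorem b_mem_verts (γ : PeanoPath D) : D.b ∈ γ.verts := (γ.mem_iff _).2 (Or.inr (Or.inl rfl))

/-- The vertices other than `a`, `b` lie in `D`. [folklore] -/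
theorem peanoPt_mem_carrier (γ : PeanoPath D) {p : ℤ × ℤ} (hp : p ∈ γ.verts) (ha : p ≠ D.a)
    (hb : p ≠ D.b) : peanoPt p ∈ D.carrier := by
  rcases (γ.mem_iff p).1 hp with h | h | h
  · exact absurd h ha
  · exact absurd h hb
  · exact h

/-- Every Peano vertex of `D` is visited. [folklore] -/
theorem mem_verts_of_mem_peanoVerts (γ : PeanoPath D) {p : ℤ × ℤ} (hp : p ∈ D.peanoVerts) :
    p ∈ γ.verts :=
  (γ.mem_iff p).2 (Or.inr (Or.inr hp))

/-- A Peano path has at least the two vertices `a ≠ b`. [folklore] -/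
theorem two_le_length (γ : PeanoPath D) : 2 ≤ γ.verts.length := by
  by_contra h
  have h1 : γ.verts.length = 1 := by
    have := List.length_pos_iff.2 γ.ne_nil
    omega
  obtain ⟨x, hx⟩ := List.length_eq_one_iff.1 h1
  have ha := γ.head_eq
  have hb := γ.getLast_eq
  simp only [hx, List.head_cons, List.getLast_singleton] at ha hb
  exact D.a_ne_b (ha.symm.trans hb)

/-- **The number of vertices is `ℓ + 2`** where `ℓ = |V_P(D)|` ([LSW04] p. 971: "let `ℓ` denote
the cardinality of `V_P ∖ {a, b}`"; the path is `(γ(0), …, γ(ℓ + 1))`, p. 973). [cite: LawlerSchrammWerner2004, §4.1] -/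
theorem length_verts (γ : PeanoPath D) : γ.verts.length = D.finite_peanoVerts.toFinset.card + 2 := by
  classical
  have hset : γ.verts.toFinset = insert D.a (insert D.b D.finite_peanoVerts.toFinset) := by
    ext p
    simp [γ.mem_iff p]
  rw [← List.toFinset_card_of_nodup γ.nodup, hset, Finset.card_insert_of_notMem,
    Finset.card_insert_of_notMem]
  · simpa using D.b_notMem_peanoVerts
  · simp only [Finset.mem_insert, Set.Finite.mem_toFinset, not_or]
    exact ⟨D.a_ne_b, D.a_notMem_peanoVerts⟩

end PeanoPath

/-! ### Finiteness and the uniform law -/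

/-- The lists of length `≤ n` with all entries in a fixed finite set form a finite set (used for
the finiteness of `PeanoPath D`). [folklore] -/
private theorem finite_setOf_list_subset {X : Type*} {S : Set X} (hS : S.Finite) :
    ∀ n : ℕ, {l : List X | l.length ≤ n ∧ ∀ x ∈ l, x ∈ S}.Finite
  | 0 => by
    refine (Set.finite_singleton ([] : List X)).subset ?_
    rintro l ⟨hl, -⟩
    exact List.eq_nil_of_length_eq_zero (Nat.le_zero.1 hl)
  | n + 1 => by
    refine ((Set.finite_singleton ([] : List X)).union
      (hS.biUnion fun x _ ↦ (finite_setOf_list_subset hS n).image (List.cons x))).subset ?_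
    rintro (_ | ⟨x, l⟩) ⟨hlen, hmem⟩
    · exact Or.inl rfl
    · refine Or.inr (Set.mem_biUnion (hmem x (by simp)) ⟨l, ⟨by simpa using hlen, fun y hy ↦ ?_⟩, rfl⟩)
      exact hmem y (by simp [hy])

namespace PeanoPath

variable {D}

/-- **There are finitely many Peano paths** (their vertices lie in the finite set
`{a, b} ∪ V_P(D)` and are not repeated). [folklore] -/
instance instFinite : Finite (PeanoPath D) := by
  classical
  set S : Set (ℤ × ℤ) := insert D.a (insert D.b D.peanoVerts) with hSdef
  have hS : S.Finite := (D.finite_peanoVerts.insert _).insert _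
  have hrange : (Set.range (PeanoPath.verts (D := D))).Finite := by
    refine (finite_setOf_list_subset hS hS.toFinset.card).subset ?_
    rintro _ ⟨γ, rfl⟩
    have hsub : ∀ x ∈ γ.verts, x ∈ S := fun x hx ↦ by
      rcases (γ.mem_iff x).1 hx with h | h | h
      · exact Or.inl h
      · exact Or.inr (Or.inl h)
      · exact Or.inr (Or.inr h)
    refine ⟨?_, hsub⟩
    rw [← List.toFinset_card_of_nodup γ.nodup]
    exact Finset.card_le_card fun x hx ↦ hS.mem_toFinset.2 (hsub x (List.mem_toFinset.1 hx))
  haveI := hrange.to_subtype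
  exact Finite.of_injective (Set.rangeFactorization (PeanoPath.verts (D := D)))
    fun γ γ' h ↦ verts_injective (by simpa [Set.rangeFactorization] using congrArg Subtype.val h)

/-- Peano paths form a finite type (noncomputably). [folklore] -/
instance instFintype : Fintype (PeanoPath D) := Fintype.ofFinite _

/-- The discrete σ-algebra on the finite set of Peano paths. [folklore] -/
instance instMeasurableSpace : MeasurableSpace (PeanoPath D) := ⊤

end PeanoPath

/-- **The law of the UST Peano path of `D = D(α, β, a, b)`**: the uniform probability measure on
the finite set of Peano paths ([LSW04] p. 972: "when `T` is the UST on `H` conditioned to contain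
`α`, `γ` is uniformly distributed among such Peano paths; it is the UST Peano path associated with
`(α, β, a, b)`"). It is Mathlib's `uniformOn univ` (counting measure normalised); if `D` had no
Peano path it would be the zero measure (this does not happen for `D ∈ 𝔇*`, LSW's bijection with
spanning trees, a separate named fact). [cite: LawlerSchrammWerner2004, §4.1] -/
def ustLaw : Measure (PeanoPath D) := ProbabilityTheory.uniformOn Set.univ

/-- The UST law is a finite measure. [folklore] -/
instance isFiniteMeasure_ustLaw : IsFiniteMeasure (ustLaw D) := by
  unfold ustLaw
  infer_instance

/-- **The UST law is a probability measure** as soon as `D` has a Peano path (Mathlib's instance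
for `uniformOn univ` on a finite nonempty type, re-exported through the definition). [folklore] -/
instance isProbabilityMeasure_ustLaw [Nonempty (PeanoPath D)] : IsProbabilityMeasure (ustLaw D) := by
  unfold ustLaw
  infer_instance

/-- Unconditionally, the UST law is either a probability measure or (if `D` had no Peano path)
the zero measure. [folklore] -/
instance isZeroOrProbabilityMeasure_ustLaw : IsZeroOrProbabilityMeasure (ustLaw D) := by
  unfold ustLaw
  infer_instance

/-- The UST law of a set of paths is its relative size `|s| / |PeanoPath D|`. [folklore] -/
theorem ustLaw_apply (s : Set (PeanoPath D)) :
    ustLaw D s = Measure.count s / Fintype.card (PeanoPath D) := by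
  classical
  rw [ustLaw, ProbabilityTheory.uniformOn_univ]

/-! ### The Peano path as a curve -/

namespace PeanoPath

variable {D}

/-- The Peano path as a **polygonal curve** `ℝ → ℂ`: `γ(k) = w_k` and affine in between (unit time
per edge of `G⃗`, i.e. speed `1/2`); the path is traversed on `[0, ℓ + 1]` from `a` to `b`
(constant after that; affine junk extension before `0`). This is the curve `γ` of [LSW04] §4.2
("let `γ = (γ(0), …, γ(ℓ + 1))` be the UST Peano path from `a` to `b` in `G⃗ ∩ D̄`").
[cite: LawlerSchrammWerner2004, §4.2] -/
def curve (γ : PeanoPath D) : ℝ → ℂ := affineInterp (γ.verts.map peanoPt)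

/-- The curve is continuous. [folklore] -/
theorem continuous_curve (γ : PeanoPath D) : Continuous γ.curve := continuous_affineInterp _

/-- The **time length** `ℓ + 1` of the Peano path (number of edges). [folklore] -/
def tlen (γ : PeanoPath D) : ℕ := γ.verts.length - 1

/-- `tlen + 1 = number of vertices`. [folklore] -/
theorem tlen_add_one (γ : PeanoPath D) : γ.tlen + 1 = γ.verts.length := by
  have := γ.two_le_length
  unfold tlen
  omega

/-- The curve passes through the vertices: `γ.curve k = w_k`. [folklore] -/
theorem curve_natCast (γ : PeanoPath D) (k : ℕ) (hk : k < γ.verts.length) :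
    γ.curve k = peanoPt (γ.verts[k]) := by
  rw [curve, affineInterp_natCast _ k (by simpa using hk)]
  simp

/-- The curve starts at `a`. [folklore] -/
@[simp] theorem curve_zero (γ : PeanoPath D) : γ.curve 0 = peanoPt D.a := by
  have := γ.curve_natCast 0 (List.length_pos_iff.2 γ.ne_nil)
  rw [Nat.cast_zero] at this
  rw [this, ← γ.head_eq, List.head_eq_getElem]

/-- The curve ends at `b` at time `ℓ + 1`. [folklore] -/
@[simp] theorem curve_tlen (γ : PeanoPath D) : γ.curve γ.tlen = peanoPt D.b := by
  have h : γ.tlen < γ.verts.length := by rw [← γ.tlen_add_one]; exact Nat.lt_succ_self _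
  rw [γ.curve_natCast _ h, ← γ.getLast_eq, List.getLast_eq_getElem]
  rfl

end PeanoPath

end USTPeano

end Literature.Probability.RandomPlanarGeometry
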